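import Summits.BirchSwinnertonDyer.BirchSwinnertonDyer.Theorems.SmallImageMuTransferMuTransferX9CoreAlgebra
import Summits.BirchSwinnertonDyer.BirchSwinnertonDyer.Theorems.SmallImageMuTransferMuTransferX9CoreStepOne
import Summits.BirchSwinnertonDyer.BirchSwinnertonDyer.Theorems.SmallImageMuTransferMuTransferX9StepZero
import Summits.BirchSwinnertonDyer.BirchSwinnertonDyer.Theorems.SmallImageMuTransferMuTransferX9StepOneImages
import Summits.BirchSwinnertonDyer.BirchSwinnertonDyer.Theorems.SmallImageMuTransferMuTransferX9StepTwoElementKernels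
import Literature.NumberTheory.EllipticCurves.Kato2004.EulerSystemClasses
import Literature.NumberTheory.EllipticCurves.Kato2004.IwasawaH1ReductionTower
import Literature.NumberTheory.EllipticCurves.KatoFineSelmerFiniteProofs
import Literature.NumberTheory.EllipticCurves.SelmerInftyTorsionFiniteProofs
import Literature.NumberTheory.EllipticCurves.WeilPairing
import Literature.NumberTheory.GaloisCohomology.PoitouTate
import Literature.NumberTheory.GaloisRepresentations.LocalEulerPoincareCharacteristic
import Literature.NumberTheory.GaloisRepresentations.BlochKatoSelmerGroup
import HarnessLib

/-!
# K6 crux `MuTransferX9` (stmt-BirchSwinnertonDyer-19276): the KERNEL COMPOSITION of skeleton v6 (class-free) —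
# the core at every odd prime from the Selmer-side stub, the Steps-3–4 stub and three published facts,
# through Step 0, Step 1, Lemma 4 and Step 2 of MU-TRANSFER-PROOF; `stub_coreX9` (v4, verbatim) as the X9 wrapper

Cell `bsd-smallim`, seat `bsd-smallim-k6-c2` (gen 3). HONEST FRAMING: theorems only (no definition, no
named fact, no `sorry`); nothing is asserted about any curve and nothing is booked. The two OPEN stubs of
the registered BC3 skeleton v6 (sha16 a90a661b046bb403; `stub_selmerDualOdd`, `stub_stepsTwoFourOdd` — the
class-free forms, hypotheses `p ≠ 2`, `E[p]` irreducible, `ρ̄` not onto, asked for by x10 GEN 38 so that N2's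
node `X10.CoreTheoremAOddPrime` is served by the same term) and the three facts of `stub_factsX9` enter as
HYPOTHESES, stated verbatim; the file proves that they imply the core at every odd prime in the shape of
`X10.CoreTheoremAOddPrime` (`coreOdd_of_selmerDual_of_stepsTwoFour`) and hence `stub_coreX9` of skeleton v4
(0154dd5daf38efd6) verbatim (`stub_coreX9_of_selmerDualOdd_of_stepsTwoFourOdd`).  Sibling of
`…X9CoreAssembly.lean` (the v5, class-X9 form).  `--supports stmt-BirchSwinnertonDyer-19276 --as helper`.

* `coreOdd_of_selmerDual_of_stepsTwoFour` — the composition (class-free, `_of_ne_two` inputs): Step 0 (`redTower_ne_zero_of_not_mem`,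
  `exists_towerShift_iterate_eq_and_towerConst_ne_zero`) → level `e = p^n`, `n = a + ε + 2` → the bad
  class `y` with `T^{2e−1} y ≠ 0` → `Ψ` (Selmer-side hypothesis) → truncation
  (`shiftH1_iterate_truncate_ne_zero`) → `exists_jointValue_weil_ne_zero_of_ne_two` → STEP 2 (x9 g43
  `exists_isArithFrobAt_mem_inf_ker_apply_eq_and_depth_of_ne_two`) → Steps-3–4 hypothesis → the count
  (`convCoeff_zero_one_eq_zero_of_reciprocity`) → contradiction.

PARTITION (D-0054): X9 (A4) × p ∈ {5,7} — helper toward `stub_coreX9`; closes none (the crux closes when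
the two stubs land).

References: HOME/koly/MU-TRANSFER-PROOF.md §§0–5; K. Kato, Astérisque 295 (2004) §13.3, §13.8, Thm. 12.4
[Kato2004Asterisque]; B. Mazur, K. Rubin, Mem. AMS 799 (2004) Prop. 1.3.2, §4.4, §5.3 [MazurRubin2004];
J. S. Milne, *Arithmetic Duality Theorems* I 2.8, 4.10 [MilneADT2006]; J. H. Silverman, *AEC* III.8.1
[SilvermanAEC2009].
-/

set_option linter.dupNamespace false
set_option autoImplicit false

noncomputable section

open scoped Classical NumberField
open WeierstrassCurve Field IsDedekindDomain
open Literature.NumberTheory.GaloisRepresentations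
open Literature.NumberTheory.GaloisCohomology
open Literature.NumberTheory.EllipticCurves
open Literature.NumberTheory.EllipticCurves.Kato2004
open Literature.NumberTheory.EllipticCurves.Kato2004.EulerSystemValues
open Summit.BirchSwinnertonDyer.BirchSwinnertonDyer.Rank1Residual

namespace Summit.BirchSwinnertonDyer.BirchSwinnertonDyer.Rank1Residual.CoreAssembly
/-- **The core at every ODD prime, class-free, from the two OPEN stubs of skeleton v6 and three published
facts** (`hred`: Kato §13.8; `hPT`: Poitou–Tate over `ℚ`; `hEP`: local Euler–Poincaré characteristic;
`hG1`: `stub_selmerDualOdd` verbatim; `hG34`: `stub_stepsTwoFourOdd` verbatim).  Conclusion in the shape of N2's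
node `X10.CoreTheoremAOddPrime` (`p ≠ 2`, good, ordinary — the last two inert —, `E[p]` irreducible, `ρ̄`
not onto): a GENUINE Λ-adic Euler-system class `s ∉ p𝐇¹` forces a power of `T = conj_γ − 1` to kill every
`E[p]`-lift of `Sel₀(ℚ_∞, E[p^∞])`.  Proof = MU-TRANSFER-PROOF §5 (module docstring).
[cite: Kato2004Asterisque, §13.3 and Thm. 12.4] [cite: MazurRubin2004, Prop. 1.3.2, §4.4, §5.3] -/
theorem coreOdd_of_selmerDual_of_stepsTwoFour (hred : mem_pSmul_of_red_eq_zero)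
    (hPT : poitouTate_sum_localTatePairing_eq_zero ℚ)
    (hEP : ∀ v : HeightOneSpectrum (𝓞 ℚ), localEulerPoincareCharacteristic (v.adicCompletion ℚ))
    (hG1 :     ∀ (W : WeierstrassCurve ℚ) [W.IsElliptic] [W.IsGloballyMinimal] (p : ℕ) [Fact p.Prime]
      (κ : ZpExtension ℚ p) (γ : absoluteGaloisGroup ℚ),
      p ≠ 2 → W.HasIrreducibleModPGaloisRep p → ¬ W.HasSurjectiveModNGaloisRep p →
      κ.IsCyclotomic → κ.IsTopGenerator γ →
      (∀ v : HeightOneSpectrum (𝓞 ℚ), localEulerPoincareCharacteristic (v.adicCompletion ℚ)) →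
      poitouTate_sum_localTatePairing_eq_zero ℚ →
      ∀ (S₀ : Set (HeightOneSpectrum (𝓞 ℚ))), S₀.Finite →
      ∃ (ε : ℕ) (S : Set (HeightOneSpectrum (𝓞 ℚ))), S.Finite ∧ S₀ ⊆ S ∧
        ∀ (J : ℕ) (y : Literature.NumberTheory.EllipticCurves.subgroupH1 κ.kerSubgroup
            (WeierstrassCurve.geomTorsion W (p : ℤ))),
          W.torsionToPrimaryH1Sub p κ.kerSubgroup y ∈ W.fineSelmerInfty κ →
          (⇑(Literature.NumberTheory.EllipticCurves.conjH1 κ.kerSubgroup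
              (WeierstrassCurve.geomTorsion W (p : ℤ)) γ -
            AddMonoidHom.id (Literature.NumberTheory.EllipticCurves.subgroupH1 κ.kerSubgroup
              (WeierstrassCurve.geomTorsion W (p : ℤ)))))^[J] y ≠ 0 →
          ∃ Ψ : galoisCohomology (W.modPTwist p κ.invTwist (J + 1)) 1,
            (κ.invTwist.shiftH1 (W.torsionGaloisModule (p : ℤ))
                (fun P : WeierstrassCurve.geomTorsion W (p : ℤ) => AddSubgroup.torsionBy.nsmul P)
                (J + 1))^[J] Ψ ≠ 0 ∧
            (∀ v : HeightOneSpectrum (𝓞 ℚ), v ∉ S →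
              galoisCohomology.localization (W.modPTwist p κ.invTwist (J + 1)) (Sum.inr v) 1 Ψ ∈
                DiscreteGaloisModule.unramifiedSubgroup
                  (GaloisRep.toLocal v (W.modPTwist p κ.invTwist (J + 1))) 1) ∧
            (∀ v : HeightOneSpectrum (𝓞 ℚ), v ∈ S →
              galoisCohomology.localization (W.modPTwist p κ.invTwist (J + 1)) (Sum.inr v) 1
                ((κ.invTwist.shiftH1 (W.torsionGaloisModule (p : ℤ))
                  (fun P : WeierstrassCurve.geomTorsion W (p : ℤ) => AddSubgroup.torsionBy.nsmul P)
                  (J + 1))^[ε] Ψ) = 0))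
    (hG34 :     ∀ (W : WeierstrassCurve ℚ) [W.IsElliptic] [W.IsGloballyMinimal] (p : ℕ) [Fact p.Prime]
      [ContinuousSMul ℤ_[p] (W.tateModule p)] [Module.Free ℤ_[p] (W.tateModule p)]
      [Module.Finite ℤ_[p] (W.tateModule p)]
      (κ : ZpExtension ℚ p) (γ : absoluteGaloisGroup ℚ) (I : IwasawaH1Data W p κ γ),
      p ≠ 2 → W.HasIrreducibleModPGaloisRep p → ¬ W.HasSurjectiveModNGaloisRep p →
      κ.IsCyclotomic → κ.IsTopGenerator γ →
      poitouTate_sum_localTatePairing_eq_zero ℚ →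
      ∀ (s : I.H), IsEulerSystemClass W p κ γ I s →
      ∃ (S₀ : Set (HeightOneSpectrum (𝓞 ℚ))), S₀.Finite ∧
        ∀ (a : ℕ) (κ' : κ.twistTower (W.torsionGaloisModule (p : ℤ))
            (fun P : WeierstrassCurve.geomTorsion W (p : ℤ) => AddSubgroup.torsionBy.nsmul P)),
          (κ.towerShift (W.torsionGaloisModule (p : ℤ))
              (fun P : WeierstrassCurve.geomTorsion W (p : ℤ) => AddSubgroup.torsionBy.nsmul P))^[a]
            κ' = I.redTower s →
          ∀ (n e' : ℕ), e' + 1 = p ^ n →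
          ∀ (Φ : contOneCocycles (W.modPTwist p κ (2 * e' + 1 + 1)).toTopRep),
            oneCocycleClass (W.modPTwist p κ (2 * e' + 1 + 1)).toTopRep Φ = κ'.1 (2 * e' + 1 + 1) →
          ∀ (ε : ℕ) (S₁ : Set (HeightOneSpectrum (𝓞 ℚ)))
            (Ψ : galoisCohomology (W.modPTwist p κ.invTwist (2 * e' + 1 + 1)) 1)
            (Ψc : contOneCocycles (W.modPTwist p κ.invTwist (2 * e' + 1 + 1)).toTopRep),
            S₀ ⊆ S₁ →
            oneCocycleClass (W.modPTwist p κ.invTwist (2 * e' + 1 + 1)).toTopRep Ψc = Ψ →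
            (∀ v : HeightOneSpectrum (𝓞 ℚ), v ∉ S₁ →
              galoisCohomology.localization (W.modPTwist p κ.invTwist (2 * e' + 1 + 1)) (Sum.inr v) 1
                  Ψ ∈
                DiscreteGaloisModule.unramifiedSubgroup
                  (GaloisRep.toLocal v (W.modPTwist p κ.invTwist (2 * e' + 1 + 1))) 1) →
            (∀ v : HeightOneSpectrum (𝓞 ℚ), v ∈ S₁ →
              galoisCohomology.localization (W.modPTwist p κ.invTwist (2 * e' + 1 + 1)) (Sum.inr v) 1
                ((κ.invTwist.shiftH1 (W.torsionGaloisModule (p : ℤ))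
                  (fun P : WeierstrassCurve.geomTorsion W (p : ℤ) => AddSubgroup.torsionBy.nsmul P)
                  (2 * e' + 1 + 1))^[ε] Ψ) = 0) →
          ∀ (eW : WeierstrassCurve.geomTorsion W (p : ℤ) → WeierstrassCurve.geomTorsion W (p : ℤ) →
              AlgebraicClosure ℚ)
            (hμ : ∀ S T, eW S T ^ p = 1)
            (hadd₁ : ∀ S₁' S₂' T, eW (S₁' + S₂') T = eW S₁' T * eW S₂' T)
            (hadd₂ : ∀ S T₁ T₂, eW S (T₁ + T₂) = eW S T₁ * eW S T₂),
            (∀ T, eW T T = 1) → (∀ T, (∀ S, eW S T = 1) → T = 0) →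
            (∀ (σ : absoluteGaloisGroup ℚ) (S T : WeierstrassCurve.geomTorsion W (p : ℤ)),
              σ • eW S T = eW (σ • S) (σ • T)) →
          ∀ (q : HeightOneSpectrum (𝓞 ℚ)), q ∉ S₁ →
          ∀ 𝔓 ∈ q.primesAbove, ∀ (Fr : absoluteGaloisGroup ℚ), IsArithFrobAt (𝓞 ℚ) Fr 𝔓 →
            WeierstrassCurve.galoisRepTorsion W p Fr = 1 →
            Fr ∈ κ.layerSubgroup n → Fr ∉ κ.layerSubgroup (n + 1) →
          ∃ U : Polynomial ℤ, ¬ ((p : ℤ) ∣ U.coeff 0) ∧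
            ∀ i : ℕ, i + ε < 2 * e' + 1 + 1 →
              convCoeff (weilPairingHom W p eW hμ hadd₁ hadd₂) (2 * e' + 1 + 1) i
                (Polynomial.aeval (shiftEnd (WeierstrassCurve.geomTorsion W (p : ℤ)) (2 * e' + 1 + 1)) U
                  ((shiftEnd (WeierstrassCurve.geomTorsion W (p : ℤ)) (2 * e' + 1 + 1) ^ (e' + 1 + a))
                    (Φ.1 Fr)))
                (Ψc.1 Fr) = 0) :
    ∀ (W : WeierstrassCurve ℚ) [W.IsElliptic] [W.IsGloballyMinimal] (p : ℕ) [Fact p.Prime]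
      [ContinuousSMul ℤ_[p] (W.tateModule p)] [Module.Free ℤ_[p] (W.tateModule p)]
      [Module.Finite ℤ_[p] (W.tateModule p)]
      (κ : ZpExtension ℚ p) (γ : absoluteGaloisGroup ℚ) (I : IwasawaH1Data W p κ γ),
      p ≠ 2 → W.HasGoodReductionAtPrime p → ¬ ((p : ℤ) ∣ W.frobeniusTrace p) →
      W.HasIrreducibleModPGaloisRep p → ¬ W.HasSurjectiveModNGaloisRep (p : ℤ) →
      κ.IsCyclotomic → κ.IsTopGenerator γ →
      (∃ s : I.H, IsEulerSystemClass W p κ γ I s ∧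
        s ∉ IwasawaAlgebra.augIdealP p • (⊤ : Submodule (IwasawaAlgebra p) I.H)) →
      ∃ J : ℕ, ∀ y : Literature.NumberTheory.EllipticCurves.subgroupH1 κ.kerSubgroup
          (WeierstrassCurve.geomTorsion W (p : ℤ)),
        W.torsionToPrimaryH1Sub p κ.kerSubgroup y ∈ W.fineSelmerInfty κ →
          (⇑(Literature.NumberTheory.EllipticCurves.conjH1 κ.kerSubgroup
              (WeierstrassCurve.geomTorsion W (p : ℤ)) γ -
            AddMonoidHom.id (Literature.NumberTheory.EllipticCurves.subgroupH1 κ.kerSubgroup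
              (WeierstrassCurve.geomTorsion W (p : ℤ)))))^[J] y = 0 := by
  intro W _ _ p _ _ _ _ κ γ I hp2 _ _ hirr hns hκ hγ hs
  obtain ⟨s, hES, hsp⟩ := hs
  have hp : p.Prime := Fact.out
  haveI : Finite (WeierstrassCurve.geomTorsion W (p : ℤ)) :=
    WeierstrassCurve.finite_torsionPoints_holds W (AlgebraicClosure ℚ) (by exact_mod_cast hp.ne_zero)
  -- STEP 0: `red_Ω s = T^a κ'`, `κ' ∉ T𝐇¹_Ω`, `κ̄' ≠ 0`
  have ht : I.redTower s ≠ 0 := I.redTower_ne_zero_of_not_mem hred hκ hγ hsp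
  obtain ⟨a, κ', hκ'a, -, hκ'c⟩ :=
    LevelE.exists_towerShift_iterate_eq_and_towerConst_ne_zero W p κ hirr ht
  -- Steps 3–4: the bad set `S₀` of the Euler system
  obtain ⟨S₀, hS₀, hG34⟩ :=
    hG34 W p κ γ I hp2 hirr hns hκ hγ hPT s hES
  -- the Selmer side: `ε`, `S₁ ⊇ S₀`
  obtain ⟨ε, S₁, hS₁, hS₀₁, hG1⟩ :=
    hG1 W p κ γ hp2 hirr hns hκ hγ hEP hPT S₀ hS₀
  -- a Weil pairing on `E[p]` and `μ_p ≃ ℤ/p`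
  obtain ⟨eW, hμ, hadd₁, hadd₂, halt, hnondeg, hgal⟩ :=
    W.exists_weilPairing_holds p hp.two_le (Nat.cast_ne_zero.mpr hp.ne_zero)
  -- suppose the conclusion fails: classes of arbitrarily large `T`-order
  by_contra hcon
  push Not at hcon
  -- the level `e = e' + 1 = p^n ≥ a + ε + 3`
  set n : ℕ := a + ε + 2 with hn
  have hlt : a + ε + 2 < p ^ n := Nat.lt_pow_self hp.one_lt
  obtain ⟨e', he⟩ : ∃ e' : ℕ, e' + 1 = p ^ n := ⟨p ^ n - 1, by omega⟩
  have he1 : 1 < e' + 1 := by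
    have : p ≤ p ^ n := Nat.le_self_pow (by omega) p
    have := hp.two_le
    omega
  -- the bad class `y` with `T^{2e−1} y ≠ 0` and the dual class `Ψ` at level `2e`
  obtain ⟨y, hy, hyT⟩ := hcon (2 * e' + 1)
  obtain ⟨Ψ, hΨT, hΨur, hΨε⟩ := hG1 (2 * e' + 1) y hy hyT
  obtain ⟨Ψc, hΨc⟩ := oneCocycleClass_surjective _ Ψ
  subst hΨc
  -- a cocycle `Φ` of `κ'_{2e}`
  obtain ⟨Φ, hΦ⟩ := oneCocycleClass_surjective _ (κ'.1 (2 * e' + 1 + 1))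
  -- truncations to level `e = e' + 1`
  have hle : e' + 1 ≤ 2 * e' + 1 + 1 := by omega
  set φ : contOneCocycles (W.modPTwist p κ (e' + 1)).toTopRep :=
    κ.pushCocycle (W.torsionGaloisModule (p : ℤ))
      (fun P : WeierstrassCurve.geomTorsion W (p : ℤ) => AddSubgroup.torsionBy.nsmul P) (2 * e' + 1 + 1)
      (κ.twistModPTruncate (W.torsionGaloisModule (p : ℤ)) _ (2 * e' + 1 + 1) hle) Φ with hφdef
  set ψ : contOneCocycles (W.modPTwist p κ.invTwist (e' + 1)).toTopRep :=
    κ.invTwist.pushCocycle (W.torsionGaloisModule (p : ℤ))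
      (fun P : WeierstrassCurve.geomTorsion W (p : ℤ) => AddSubgroup.torsionBy.nsmul P) (2 * e' + 1 + 1)
      (κ.invTwist.twistModPTruncate (W.torsionGaloisModule (p : ℤ)) _ (2 * e' + 1 + 1) hle) Ψc
    with hψdef
  have hφ : oneCocycleClass (W.modPTwist p κ (e' + 1)).toTopRep φ = κ'.1 (e' + 1) := by
    have h1 := (κ.mem_twistTower_iff (W.torsionGaloisModule (p : ℤ)) _ κ'.1).1 κ'.2 _ _ hle
    rw [← hΦ] at h1
    exact (ZpExtension.map_oneCocycleClass_twist κ (W.torsionGaloisModule (p : ℤ)) _ (2 * e' + 1 + 1)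
      (κ.twistModPTruncate (W.torsionGaloisModule (p : ℤ)) _ (2 * e' + 1 + 1) hle) Φ).symm.trans h1
  have hψT : (κ.invTwist.shiftH1 (W.torsionGaloisModule (p : ℤ))
      (fun P : WeierstrassCurve.geomTorsion W (p : ℤ) => AddSubgroup.torsionBy.nsmul P) (e' + 1))^[e']
        (oneCocycleClass (W.modPTwist p κ.invTwist (e' + 1)).toTopRep ψ) ≠ 0 :=
    shiftH1_iterate_truncate_ne_zero κ.invTwist (W.torsionGaloisModule (p : ℤ)) _ e' Ψc hΨT hle
  -- STEP 1 + LEMMA 4: a joint value `z` of `(φ, ψ)` whose two lowest pairing coefficients do not both vanish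
  haveI : NeZero p := ⟨hp.ne_zero⟩
  obtain ⟨z, hzMj, hz01⟩ := exists_jointValue_weil_ne_zero_of_ne_two W p κ hp2 hirr hns hγ
    κ' hκ'c he1 φ hφ ψ hψT eW hμ hadd₁ hadd₂ hnondeg
  -- STEP 2 (x9 g43): an `E`-split prime `q ∉ S₁` of depth `n` with a Frobenius realising `z`
  obtain ⟨N, -, -, -, -, -, -, q, hq, -, 𝔓, h𝔓, Fr, hFr, -, hφFr, hψFr, hFr1, hFrn, hFrn1⟩ :=
    exists_isArithFrobAt_mem_inf_ker_apply_eq_and_depth_of_ne_two W p κ hp2 hirr hns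
      (J := e' + 1) (J' := e' + 1) (n := n) (by omega) he.le he.le φ ψ hzMj S₁ hS₁
  -- STEPS 3–4 (stub): the Kolyvagin class and reciprocity at `q`
  obtain ⟨U, hU0, hrec⟩ := hG34 a κ' hκ'a n e' he Φ hΦ ε S₁ _ Ψc hS₀₁ rfl hΨur hΨε eW hμ hadd₁ hadd₂
    halt hnondeg hgal q hq 𝔓 h𝔓 Fr hFr hFr1 hFrn hFrn1
  -- the count: `C_0 = C_1 = 0` for the level-`2e` pair `(Φ(Fr), Ψc(Fr))`
  have hpC : ∀ c : DiscreteGaloisModule.MuCarrier ℚ p, (p : ℤ) • c = 0 :=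
    natCast_zsmul_muCarrier_eq_zero ℚ p
  obtain ⟨hC0, hC1⟩ := convCoeff_zero_one_eq_zero_of_reciprocity (weilPairingHom W p eW hμ hadd₁ hadd₂) hp hpC
    (m := e' + 1 + a) (ε := ε) (by omega) U hU0 (Φ.1 Fr) (Ψc.1 Fr) hrec
  -- the two lowest coefficients of the level-`2e` pair are those of `z` (truncation is definitional)
  have hk10 : Φ.1 Fr ⟨0, by omega⟩ = z.1 ⟨0, by omega⟩ := by rw [← hφFr]; rfl
  have hk11 : Φ.1 Fr ⟨1, by omega⟩ = z.1 ⟨1, he1⟩ := by rw [← hφFr]; rfl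
  have hcy0 : Ψc.1 Fr ⟨0, by omega⟩ = z.2 ⟨0, by omega⟩ := by rw [← hψFr]; rfl
  have hcy1 : Ψc.1 Fr ⟨1, by omega⟩ = z.2 ⟨1, he1⟩ := by rw [← hψFr]; rfl
  rw [convCoeff_zero_eq _ (by omega), hk10, hcy0] at hC0
  rw [convCoeff_one_eq _ (by omega), hk10, hcy1, hk11, hcy0] at hC1
  -- contradiction with the valuation `≤ 1` of `z`
  rcases hz01 with h0 | h1
  · exact h0 hC0
  · exact h1 hC1




/-- **`stub_coreX9` of skeleton v4 (verbatim) from the v6 stubs** — the class-X9 wrapper (`p ≥ 5` is odd).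
[cite: Kato2004Asterisque, §13.3 and Thm. 12.4] -/
theorem stub_coreX9_of_selmerDualOdd_of_stepsTwoFourOdd (hred : mem_pSmul_of_red_eq_zero)
    (hPT : poitouTate_sum_localTatePairing_eq_zero ℚ)
    (hEP : ∀ v : HeightOneSpectrum (𝓞 ℚ), localEulerPoincareCharacteristic (v.adicCompletion ℚ))
    (hG1 :     ∀ (W : WeierstrassCurve ℚ) [W.IsElliptic] [W.IsGloballyMinimal] (p : ℕ) [Fact p.Prime]
      (κ : ZpExtension ℚ p) (γ : absoluteGaloisGroup ℚ),
      p ≠ 2 → W.HasIrreducibleModPGaloisRep p → ¬ W.HasSurjectiveModNGaloisRep p →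
      κ.IsCyclotomic → κ.IsTopGenerator γ →
      (∀ v : HeightOneSpectrum (𝓞 ℚ), localEulerPoincareCharacteristic (v.adicCompletion ℚ)) →
      poitouTate_sum_localTatePairing_eq_zero ℚ →
      ∀ (S₀ : Set (HeightOneSpectrum (𝓞 ℚ))), S₀.Finite →
      ∃ (ε : ℕ) (S : Set (HeightOneSpectrum (𝓞 ℚ))), S.Finite ∧ S₀ ⊆ S ∧
        ∀ (J : ℕ) (y : Literature.NumberTheory.EllipticCurves.subgroupH1 κ.kerSubgroup
            (WeierstrassCurve.geomTorsion W (p : ℤ))),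
          W.torsionToPrimaryH1Sub p κ.kerSubgroup y ∈ W.fineSelmerInfty κ →
          (⇑(Literature.NumberTheory.EllipticCurves.conjH1 κ.kerSubgroup
              (WeierstrassCurve.geomTorsion W (p : ℤ)) γ -
            AddMonoidHom.id (Literature.NumberTheory.EllipticCurves.subgroupH1 κ.kerSubgroup
              (WeierstrassCurve.geomTorsion W (p : ℤ)))))^[J] y ≠ 0 →
          ∃ Ψ : galoisCohomology (W.modPTwist p κ.invTwist (J + 1)) 1,
            (κ.invTwist.shiftH1 (W.torsionGaloisModule (p : ℤ))
                (fun P : WeierstrassCurve.geomTorsion W (p : ℤ) => AddSubgroup.torsionBy.nsmul P)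
                (J + 1))^[J] Ψ ≠ 0 ∧
            (∀ v : HeightOneSpectrum (𝓞 ℚ), v ∉ S →
              galoisCohomology.localization (W.modPTwist p κ.invTwist (J + 1)) (Sum.inr v) 1 Ψ ∈
                DiscreteGaloisModule.unramifiedSubgroup
                  (GaloisRep.toLocal v (W.modPTwist p κ.invTwist (J + 1))) 1) ∧
            (∀ v : HeightOneSpectrum (𝓞 ℚ), v ∈ S →
              galoisCohomology.localization (W.modPTwist p κ.invTwist (J + 1)) (Sum.inr v) 1
                ((κ.invTwist.shiftH1 (W.torsionGaloisModule (p : ℤ))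
                  (fun P : WeierstrassCurve.geomTorsion W (p : ℤ) => AddSubgroup.torsionBy.nsmul P)
                  (J + 1))^[ε] Ψ) = 0))
    (hG34 :     ∀ (W : WeierstrassCurve ℚ) [W.IsElliptic] [W.IsGloballyMinimal] (p : ℕ) [Fact p.Prime]
      [ContinuousSMul ℤ_[p] (W.tateModule p)] [Module.Free ℤ_[p] (W.tateModule p)]
      [Module.Finite ℤ_[p] (W.tateModule p)]
      (κ : ZpExtension ℚ p) (γ : absoluteGaloisGroup ℚ) (I : IwasawaH1Data W p κ γ),
      p ≠ 2 → W.HasIrreducibleModPGaloisRep p → ¬ W.HasSurjectiveModNGaloisRep p →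
      κ.IsCyclotomic → κ.IsTopGenerator γ →
      poitouTate_sum_localTatePairing_eq_zero ℚ →
      ∀ (s : I.H), IsEulerSystemClass W p κ γ I s →
      ∃ (S₀ : Set (HeightOneSpectrum (𝓞 ℚ))), S₀.Finite ∧
        ∀ (a : ℕ) (κ' : κ.twistTower (W.torsionGaloisModule (p : ℤ))
            (fun P : WeierstrassCurve.geomTorsion W (p : ℤ) => AddSubgroup.torsionBy.nsmul P)),
          (κ.towerShift (W.torsionGaloisModule (p : ℤ))
              (fun P : WeierstrassCurve.geomTorsion W (p : ℤ) => AddSubgroup.torsionBy.nsmul P))^[a]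
            κ' = I.redTower s →
          ∀ (n e' : ℕ), e' + 1 = p ^ n →
          ∀ (Φ : contOneCocycles (W.modPTwist p κ (2 * e' + 1 + 1)).toTopRep),
            oneCocycleClass (W.modPTwist p κ (2 * e' + 1 + 1)).toTopRep Φ = κ'.1 (2 * e' + 1 + 1) →
          ∀ (ε : ℕ) (S₁ : Set (HeightOneSpectrum (𝓞 ℚ)))
            (Ψ : galoisCohomology (W.modPTwist p κ.invTwist (2 * e' + 1 + 1)) 1)
            (Ψc : contOneCocycles (W.modPTwist p κ.invTwist (2 * e' + 1 + 1)).toTopRep),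
            S₀ ⊆ S₁ →
            oneCocycleClass (W.modPTwist p κ.invTwist (2 * e' + 1 + 1)).toTopRep Ψc = Ψ →
            (∀ v : HeightOneSpectrum (𝓞 ℚ), v ∉ S₁ →
              galoisCohomology.localization (W.modPTwist p κ.invTwist (2 * e' + 1 + 1)) (Sum.inr v) 1
                  Ψ ∈
                DiscreteGaloisModule.unramifiedSubgroup
                  (GaloisRep.toLocal v (W.modPTwist p κ.invTwist (2 * e' + 1 + 1))) 1) →
            (∀ v : HeightOneSpectrum (𝓞 ℚ), v ∈ S₁ →
              galoisCohomology.localization (W.modPTwist p κ.invTwist (2 * e' + 1 + 1)) (Sum.inr v) 1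
                ((κ.invTwist.shiftH1 (W.torsionGaloisModule (p : ℤ))
                  (fun P : WeierstrassCurve.geomTorsion W (p : ℤ) => AddSubgroup.torsionBy.nsmul P)
                  (2 * e' + 1 + 1))^[ε] Ψ) = 0) →
          ∀ (eW : WeierstrassCurve.geomTorsion W (p : ℤ) → WeierstrassCurve.geomTorsion W (p : ℤ) →
              AlgebraicClosure ℚ)
            (hμ : ∀ S T, eW S T ^ p = 1)
            (hadd₁ : ∀ S₁' S₂' T, eW (S₁' + S₂') T = eW S₁' T * eW S₂' T)
            (hadd₂ : ∀ S T₁ T₂, eW S (T₁ + T₂) = eW S T₁ * eW S T₂),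
            (∀ T, eW T T = 1) → (∀ T, (∀ S, eW S T = 1) → T = 0) →
            (∀ (σ : absoluteGaloisGroup ℚ) (S T : WeierstrassCurve.geomTorsion W (p : ℤ)),
              σ • eW S T = eW (σ • S) (σ • T)) →
          ∀ (q : HeightOneSpectrum (𝓞 ℚ)), q ∉ S₁ →
          ∀ 𝔓 ∈ q.primesAbove, ∀ (Fr : absoluteGaloisGroup ℚ), IsArithFrobAt (𝓞 ℚ) Fr 𝔓 →
            WeierstrassCurve.galoisRepTorsion W p Fr = 1 →
            Fr ∈ κ.layerSubgroup n → Fr ∉ κ.layerSubgroup (n + 1) →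
          ∃ U : Polynomial ℤ, ¬ ((p : ℤ) ∣ U.coeff 0) ∧
            ∀ i : ℕ, i + ε < 2 * e' + 1 + 1 →
              convCoeff (weilPairingHom W p eW hμ hadd₁ hadd₂) (2 * e' + 1 + 1) i
                (Polynomial.aeval (shiftEnd (WeierstrassCurve.geomTorsion W (p : ℤ)) (2 * e' + 1 + 1)) U
                  ((shiftEnd (WeierstrassCurve.geomTorsion W (p : ℤ)) (2 * e' + 1 + 1) ^ (e' + 1 + a))
                    (Φ.1 Fr)))
                (Ψc.1 Fr) = 0) :
    ∀ (W : WeierstrassCurve ℚ) [W.IsElliptic] [W.IsGloballyMinimal] (p : ℕ) [Fact p.Prime]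
      [ContinuousSMul ℤ_[p] (W.tateModule p)] [Module.Free ℤ_[p] (W.tateModule p)]
      [Module.Finite ℤ_[p] (W.tateModule p)]
      (κ : ZpExtension ℚ p) (γ : absoluteGaloisGroup ℚ) (I : IwasawaH1Data W p κ γ),
      Summit.BirchSwinnertonDyer.BirchSwinnertonDyer.Rank1Residual.ClassX9 W p →
      κ.IsCyclotomic → κ.IsTopGenerator γ →
      (∃ s : I.H, IsEulerSystemClass W p κ γ I s ∧
        s ∉ IwasawaAlgebra.augIdealP p • (⊤ : Submodule (IwasawaAlgebra p) I.H)) →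
      ∃ J : ℕ, ∀ y : Literature.NumberTheory.EllipticCurves.subgroupH1 κ.kerSubgroup
          (WeierstrassCurve.geomTorsion W (p : ℤ)),
        W.torsionToPrimaryH1Sub p κ.kerSubgroup y ∈ W.fineSelmerInfty κ →
          (⇑(Literature.NumberTheory.EllipticCurves.conjH1 κ.kerSubgroup
              (WeierstrassCurve.geomTorsion W (p : ℤ)) γ -
            AddMonoidHom.id (Literature.NumberTheory.EllipticCurves.subgroupH1 κ.kerSubgroup
              (WeierstrassCurve.geomTorsion W (p : ℤ)))))^[J] y = 0 := by
  intro W _ _ p _ _ _ _ κ γ I hX9 hκ hγ hs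
  obtain ⟨_, hp5, hgood, hap, hirr, hns⟩ := hX9
  exact coreOdd_of_selmerDual_of_stepsTwoFour hred hPT hEP hG1 hG34 W p κ γ I (by omega) hgood hap hirr hns
    hκ hγ hs

end Summit.BirchSwinnertonDyer.BirchSwinnertonDyer.Rank1Residual.CoreAssembly

end
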